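import Summits.BirchSwinnertonDyer.BirchSwinnertonDyer.Theorems.ManinLocalTwoThreeManinPrimeToAdditiveFiveLeTypeIIAtFiveCornerOfUnstarredLaw
import Summits.BirchSwinnertonDyer.BirchSwinnertonDyer.Theorems.ManinLocalTwoThreeManinPrimeToAdditiveFiveLeRedFiveSevenCells
import Summits.BirchSwinnertonDyer.BirchSwinnertonDyer.Theorems.ManinLocalTwoThreeManinPrimeToAdditiveFiveLeLedgerByName
import Summits.BirchSwinnertonDyer.BirchSwinnertonDyer.Theorems.ManinLocalTwoThreeManinPrimeToAdditiveFiveLeReducibleResidueSharp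
import HarnessLib

/-!
# Route `ManinLocalTwoThree`, residual crux C5 `ManinPrimeToAdditiveFiveLe`
# (stmt-BirchSwinnertonDyer-22969), line `upper_anchor` (skeleton v11 → v12; sequel of the width seat's υ5 p628635): **the STARRED half of the `W[p]`-reducible residue at
# `p ∈ {5, 7}` needs neither the twist transport θ nor Dokchitser–Dokchitser — its potentially ordinary rows ARE rows of
# `OrdinaryCornerManinResidual` (stmt-27552), its potentially supersingular rows are EMPTY under the orientation law (U)**

Lead seat bsd-line-ml23-c5-p1 (gen 6). Since skeleton v6 the reducible residue RED(57♯) of C5 at `p ∈ {5,7}` was split by the Kodaira side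
(θ, p617914 `coreRED57sharp_of_cns_of_unstarred_of_bistarred`): the STARRED optimal curves were carried to their UNSTARRED `χ_{p*}`-partners
by the an-cell's Manin transport, up to the «bi-starred corner», whose (G)-ordinary half needed the cite-only Dokchitser–Dokchitser 2015
Thm. 5.1 (1) (p621355). With route `TwistFamilyManinDescent`'s item `OrdinaryCornerManinResidual` (stmt-27552: Manin for the lattice-optimal
curve on ALL potentially ordinary reducible corner rows `(5; III/III*)`, `(7; II/IV/IV*/II*)`, starred rows INCLUDED) now consumed BY NAME
(skeleton v11), the starred half is simpler:

* (plumbing used) the three Raynaud cells of the lead's gen-5 split (`coreRED57unstarredOffII5_of_cells`, p625709) from the two items BY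
  NAME are the width seat's υ5 (p628635, `…LedgerByName.lean`): `red57ss_of_ssUnstarredStrong` (K15b stmt-27071 ⟹ cell SS57),
  `red7ordIV_of_ordinaryCorner`, `red57corner_of_ordinaryCorner` (stmt-27552 ⟹ cells ORD7, CORNER57).
* §2 `coreRED57starred_of_ordinaryCorner_of_optimalUnstarredNonGord` — **the starred residue (`4 < ord_p Δ_min`, all RED(57♯) cuts)
  ⟸ stmt-27552 ∧ (U)**: by Ogg–Tate (`kodairaSymbolAt_placeOf_cases_of_addv`) a starred additive fibre without `Iₙ*` has
  `(p; ord_p Δ_min) ∈ {(5;8), (5;9), (5;10), (7;8), (7;9), (7;10)}`; the rows `(5;9)`, `(7;8)`, `(7;10)` have tame index `e ∣ p − 1`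
  and are rows of 27552 verbatim; the rows `(5;8)`, `(5;10)`, `(7;9)` have `e = 3, 6, 4 ∤ p − 1`, so the curve is not (G)
  (`subGord_iff_typeG_of_addv`), hence not (G)-ordinary, and (U) («optimal ∧ reducible ∧ not (G)-ordinary ⟹ `ord_p Δ_min ≤ 4`»)
  makes the row EMPTY. No Manin transport, no D–D, no ČNS.
* §3 `coreRED57sharp_of_unstarred_of_starred` — RED(57♯) (hypothesis `h57s` of p612504, VERBATIM) from its unstarred half (`hlow` of
  θ, verbatim) and the starred half of §2's shape (trivial case split); and BY NAME:
  `coreRED57sharp_of_cns_of_items_of_optimalUnstarredNonGord` — **RED(57♯) ⟸ ČNS ∧ K15b ∧ stmt-27552 ∧ (U)** (unstarred half = the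
  lead's flip-twin reduction p622240 over the cells of §1 and μ p623176); with (U) ⟸ Gealy–Klagsbrun ∧ E-imc-5 at 5, 7 (υ p626338,
  `optimalUnstarredNonGord57_of_acrossIsogeny_of_gealyKlagsbrun`) this is RED(57♯) from registered statements only (skeleton v12).

NET for the skeleton (v12): Dokchitser–Dokchitser 2015 LEAVES the cone of C5 (7 cite-only printed facts instead of 8); θ's transport and
the bi-starred corner are no longer on the composition path. HONEST STATUS: conditional results (`--supports`, helper) on OPEN items
(27071, 27552) and OPEN laws ((U) / E-imc-5) plus cite-only facts (ČNS, GK); nothing here proves any of them, C5, Manin's conjecture or BSD.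

References: [EdixhovenManin1991] Thm. 3, Prop. 7, §4; [KostersPannekoek2017] Thm. 1; [Stevens1989] §2; [GealyKlagsbrun2017] Thm. 1;
[CesnaviciusNeururerSaha2023] Thm. 1.2; [SerreTate1968] §2 Cor. 3; [SilvermanATAEC1994] IV Table 4.1; [Delbourgo1998] §1.5.
-/

set_option autoImplicit false
-- the Theorems namespace of this sub repeats the summit name by design (D-0017 nested layout)
set_option linter.dupNamespace false

noncomputable section

open scoped Classical NumberField

namespace Summit.BirchSwinnertonDyer.BirchSwinnertonDyer.Theorems

open WeierstrassCurve IsDedekindDomain IsDedekindDomain.HeightOneSpectrum Rat.HeightOneSpectrum NumberField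
  Literature.NumberTheory.EllipticCurves Literature.NumberTheory.EllipticCurves.ModularForms
  Literature.NumberTheory.EllipticCurves.Rank1Residual
  Literature.NumberTheory.DiophantineGeometry
  Summit.BirchSwinnertonDyer.Rank1Residual.ManinAdditive
  Summit.BirchSwinnertonDyer.Rank1Residual.Additive

/-! ## §2 The STARRED residue from stmt-27552 and the orientation law (U) — no transport, no D–D -/

/-- **The starred `W[p]`-reducible residue at `p ∈ {5, 7}` (all RED(57♯) cuts, `4 < ord_p Δ_min`) ⟸ `OrdinaryCornerManinResidual`
(stmt-27552) ∧ law (U)** (`hU` = the hypothesis of μ p623176, VERBATIM). Rows `(5;9)`, `(7;8)`, `(7;10)` are rows of 27552; rows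
`(5;8)`, `(5;10)`, `(7;9)` have tame index `∤ p − 1`, are not (G), and (U) empties them. Conditional result between OPEN statements;
closes nothing. [cite: EdixhovenManin1991, Thm. 3] [cite: Stevens1989, §2] [cite: SilvermanATAEC1994, IV Table 4.1] [cite: Delbourgo1998, §1.5] -/
theorem coreRED57starred_of_ordinaryCorner_of_optimalUnstarredNonGord
    (hOrd : Summit.BirchSwinnertonDyer.BirchSwinnertonDyer.Theses.TwistFamilyManinDescent.OrdinaryCornerManinResidual)
    (hU : exists_isNewformOf →
      ∀ (W : WeierstrassCurve ℚ) [W.IsElliptic] [W.IsGloballyMinimal] [NeZero (W.conductorNorm ℤ)]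
        (D : ModularParametrizationData W (W.conductorNorm ℤ)),
        IsLatticeOptimal D → ∀ (p : ℕ) (hp : p.Prime), (p = 5 ∨ p = 7) → p ^ 2 ∣ W.conductorNorm ℤ →
        ¬ (∃ (W' : WeierstrassCurve ℚ) (q : ℕ), W'.IsElliptic ∧ W'.IsGloballyMinimal ∧ q.Prime ∧
            q ≠ 2 ∧ q ^ 2 ∣ W.conductorNorm ℤ ∧
            IsIsogenous W (W'.quadraticTwist (((-1 : ℤ) ^ (q / 2) * q : ℤ) : ℚ)) ∧
            ¬ q ^ 2 ∣ W'.conductorNorm ℤ) →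
        ¬ (∃ (W' : WeierstrassCurve ℚ) (d : ℤ), W'.IsElliptic ∧ W'.IsGloballyMinimal ∧
            (d = -1 ∨ d = 2 ∨ d = -2) ∧ 2 ^ 2 ∣ W.conductorNorm ℤ ∧
            IsIsogenous W (W'.quadraticTwist (d : ℚ)) ∧ ¬ 2 ^ 2 ∣ W'.conductorNorm ℤ) →
        ¬ W.HasIrreducibleModPGaloisRep p →
        500000 < W.conductorNorm ℤ →
        (∀ n : ℕ, W.kodairaSymbolAt ((Rat.HeightOneSpectrum.primesEquiv (R := ℤ)).symm ⟨p, hp⟩) ≠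
          .Istar n) →
        ¬ TypeGOrd W p →
        padicValInt p W.minimalDiscriminantInt ≤ 4) :
    mazur_not_dvd_maninConstant_of_odd → abbesUllmo_not_dvd_maninConstant_of_not_dvd_level →
    cesnavicius_not_two_dvd_maninConstant_of_two_dvd_level → exists_isNewformOf →
    ∀ (W : WeierstrassCurve ℚ) [W.IsElliptic] [W.IsGloballyMinimal] [NeZero (W.conductorNorm ℤ)]
      (D : ModularParametrizationData W (W.conductorNorm ℤ)),
      IsLatticeOptimal D → ∀ (p : ℕ) (hp : p.Prime), (p = 5 ∨ p = 7) → p ^ 2 ∣ W.conductorNorm ℤ →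
      ¬ (∃ (W' : WeierstrassCurve ℚ) (q : ℕ), W'.IsElliptic ∧ W'.IsGloballyMinimal ∧ q.Prime ∧
          q ≠ 2 ∧ q ^ 2 ∣ W.conductorNorm ℤ ∧
          IsIsogenous W (W'.quadraticTwist (((-1 : ℤ) ^ (q / 2) * q : ℤ) : ℚ)) ∧
          ¬ q ^ 2 ∣ W'.conductorNorm ℤ) →
      ¬ (∃ (W' : WeierstrassCurve ℚ) (d : ℤ), W'.IsElliptic ∧ W'.IsGloballyMinimal ∧
          (d = -1 ∨ d = 2 ∨ d = -2) ∧ 2 ^ 2 ∣ W.conductorNorm ℤ ∧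
          IsIsogenous W (W'.quadraticTwist (d : ℚ)) ∧ ¬ 2 ^ 2 ∣ W'.conductorNorm ℤ) →
      ¬ W.HasIrreducibleModPGaloisRep p →
      500000 < W.conductorNorm ℤ →
      p ∣ D.modularDegree →
      (∀ n : ℕ, W.kodairaSymbolAt ((Rat.HeightOneSpectrum.primesEquiv (R := ℤ)).symm ⟨p, hp⟩) ≠
        .Istar n) →
      4 < padicValInt p W.minimalDiscriminantInt →
      ¬ (p : ℤ) ∣ D.maninConstant := by
  intro hM hAU hC hnf W _ _ _ D hD p hp h57 hpN hodd hdy hred hN _hdeg hI hv4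
  haveI hpF : Fact p.Prime := ⟨hp⟩
  have h5 : 5 ≤ p := by rcases h57 with rfl | rfl <;> norm_num
  have hp2 : p ≠ 2 := by omega
  have hadd : Addv W p := not_good_and_not_mult_of_sq_dvd_conductorNorm W hpN
  have htw := quadraticTwist_pStar_additive_of_twistMinimal W hp hp2 hpN hodd
  -- (U) empties every starred row whose tame index does not divide `p − 1`
  have hGord : TypeGOrd W p := by
    by_contra hG
    have hle := hU hnf W D hD p hp h57 hpN hodd hdy hred hN hI hG
    omega
  have hS : SubGord W p := (subGord_iff_typeG_of_addv W p hp2 hadd).mpr hGord.typeG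
  obtain ⟨-, -, hdvd⟩ := hS
  unfold semistabilityIndex at hdvd
  -- Ogg–Tate: the starred rows are `ord_p Δ_min ∈ {8, 9, 10}`
  rcases kodairaSymbolAt_placeOf_cases_of_addv W p h5 hadd with
    ⟨-, h⟩ | ⟨-, h⟩ | ⟨-, h⟩ | ⟨m, hm, -⟩ | ⟨-, h⟩ | ⟨-, h⟩ | ⟨-, h⟩
  · omega
  · omega
  · omega
  · exact absurd hm (hI m)
  · -- `ord_p Δ_min = 8` (IV*, `e = 3`): at 5 not (G) — excluded above; at 7 a row of 27552
    rcases h57 with rfl | rfl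
    · rw [h] at hdvd; norm_num at hdvd
    · refine hOrd hM hAU hC hnf W D 7 hp (Or.inr rfl) ?_ ?_ hpN hred htw hD
      · rintro (⟨h', -⟩ | ⟨-, h'⟩)
        · norm_num at h'
        · rw [h] at h'
          simp at h'
      · rintro ⟨h', -⟩
        norm_num at h'
  · -- `ord_p Δ_min = 9` (III*, `e = 4`): at 5 a row of 27552; at 7 not (G)
    rcases h57 with rfl | rfl
    · refine hOrd hM hAU hC hnf W D 5 hp (Or.inl rfl) ?_ ?_ hpN hred htw hD
      · rintro (⟨-, h'⟩ | ⟨h', -⟩)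
        · rw [h] at h'
          simp at h'
        · norm_num at h'
      · rintro ⟨-, h'⟩
        rw [h] at h'
        simp at h'
    · rw [h] at hdvd; norm_num at hdvd
  · -- `ord_p Δ_min = 10` (II*, `e = 6`): at 5 not (G); at 7 a row of 27552
    rcases h57 with rfl | rfl
    · rw [h] at hdvd; norm_num at hdvd
    · refine hOrd hM hAU hC hnf W D 7 hp (Or.inr rfl) ?_ ?_ hpN hred htw hD
      · rintro (⟨h', -⟩ | ⟨-, h'⟩)
        · norm_num at h'
        · rw [h] at h'
          simp at h'
      · rintro ⟨h', -⟩
        norm_num at h'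

/-! ## §3 RED(57♯) from its unstarred and starred halves; and BY NAME -/

/-- **RED(57♯) (hypothesis `h57s` of p612504, VERBATIM) ⟸ its UNSTARRED half (`hlow` of θ p617914, verbatim) ∧ its STARRED half
(the shape of §2's conclusion)** — trivial case split on `ord_p Δ_min ≤ 4`. [cite: SilvermanATAEC1994, IV Table 4.1] -/
theorem coreRED57sharp_of_unstarred_of_starred
    (hlow : mazur_not_dvd_maninConstant_of_odd → abbesUllmo_not_dvd_maninConstant_of_not_dvd_level →
      cesnavicius_not_two_dvd_maninConstant_of_two_dvd_level → exists_isNewformOf →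
      ∀ (W : WeierstrassCurve ℚ) [W.IsElliptic] [W.IsGloballyMinimal] [NeZero (W.conductorNorm ℤ)]
        (D : ModularParametrizationData W (W.conductorNorm ℤ)),
        IsLatticeOptimal D → ∀ (p : ℕ) (hp : p.Prime), (p = 5 ∨ p = 7) → p ^ 2 ∣ W.conductorNorm ℤ →
        ¬ (∃ (W' : WeierstrassCurve ℚ) (q : ℕ), W'.IsElliptic ∧ W'.IsGloballyMinimal ∧ q.Prime ∧
            q ≠ 2 ∧ q ^ 2 ∣ W.conductorNorm ℤ ∧
            IsIsogenous W (W'.quadraticTwist (((-1 : ℤ) ^ (q / 2) * q : ℤ) : ℚ)) ∧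
            ¬ q ^ 2 ∣ W'.conductorNorm ℤ) →
        ¬ (∃ (W' : WeierstrassCurve ℚ) (d : ℤ), W'.IsElliptic ∧ W'.IsGloballyMinimal ∧
            (d = -1 ∨ d = 2 ∨ d = -2) ∧ 2 ^ 2 ∣ W.conductorNorm ℤ ∧
            IsIsogenous W (W'.quadraticTwist (d : ℚ)) ∧ ¬ 2 ^ 2 ∣ W'.conductorNorm ℤ) →
        ¬ W.HasIrreducibleModPGaloisRep p →
        500000 < W.conductorNorm ℤ →
        p ∣ D.modularDegree →
        (∀ n : ℕ, W.kodairaSymbolAt ((Rat.HeightOneSpectrum.primesEquiv (R := ℤ)).symm ⟨p, hp⟩) ≠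
          .Istar n) →
        padicValInt p W.minimalDiscriminantInt ≤ 4 →
        ¬ (p : ℤ) ∣ D.maninConstant)
    (hstar : mazur_not_dvd_maninConstant_of_odd → abbesUllmo_not_dvd_maninConstant_of_not_dvd_level →
      cesnavicius_not_two_dvd_maninConstant_of_two_dvd_level → exists_isNewformOf →
      ∀ (W : WeierstrassCurve ℚ) [W.IsElliptic] [W.IsGloballyMinimal] [NeZero (W.conductorNorm ℤ)]
        (D : ModularParametrizationData W (W.conductorNorm ℤ)),
        IsLatticeOptimal D → ∀ (p : ℕ) (hp : p.Prime), (p = 5 ∨ p = 7) → p ^ 2 ∣ W.conductorNorm ℤ →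
        ¬ (∃ (W' : WeierstrassCurve ℚ) (q : ℕ), W'.IsElliptic ∧ W'.IsGloballyMinimal ∧ q.Prime ∧
            q ≠ 2 ∧ q ^ 2 ∣ W.conductorNorm ℤ ∧
            IsIsogenous W (W'.quadraticTwist (((-1 : ℤ) ^ (q / 2) * q : ℤ) : ℚ)) ∧
            ¬ q ^ 2 ∣ W'.conductorNorm ℤ) →
        ¬ (∃ (W' : WeierstrassCurve ℚ) (d : ℤ), W'.IsElliptic ∧ W'.IsGloballyMinimal ∧
            (d = -1 ∨ d = 2 ∨ d = -2) ∧ 2 ^ 2 ∣ W.conductorNorm ℤ ∧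
            IsIsogenous W (W'.quadraticTwist (d : ℚ)) ∧ ¬ 2 ^ 2 ∣ W'.conductorNorm ℤ) →
        ¬ W.HasIrreducibleModPGaloisRep p →
        500000 < W.conductorNorm ℤ →
        p ∣ D.modularDegree →
        (∀ n : ℕ, W.kodairaSymbolAt ((Rat.HeightOneSpectrum.primesEquiv (R := ℤ)).symm ⟨p, hp⟩) ≠
          .Istar n) →
        4 < padicValInt p W.minimalDiscriminantInt →
        ¬ (p : ℤ) ∣ D.maninConstant) :
    mazur_not_dvd_maninConstant_of_odd → abbesUllmo_not_dvd_maninConstant_of_not_dvd_level →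
    cesnavicius_not_two_dvd_maninConstant_of_two_dvd_level → exists_isNewformOf →
    ∀ (W : WeierstrassCurve ℚ) [W.IsElliptic] [W.IsGloballyMinimal] [NeZero (W.conductorNorm ℤ)]
      (D : ModularParametrizationData W (W.conductorNorm ℤ)),
      IsLatticeOptimal D → ∀ (p : ℕ) (hp : p.Prime), (p = 5 ∨ p = 7) → p ^ 2 ∣ W.conductorNorm ℤ →
      ¬ (∃ (W' : WeierstrassCurve ℚ) (q : ℕ), W'.IsElliptic ∧ W'.IsGloballyMinimal ∧ q.Prime ∧
          q ≠ 2 ∧ q ^ 2 ∣ W.conductorNorm ℤ ∧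
          IsIsogenous W (W'.quadraticTwist (((-1 : ℤ) ^ (q / 2) * q : ℤ) : ℚ)) ∧
          ¬ q ^ 2 ∣ W'.conductorNorm ℤ) →
      ¬ (∃ (W' : WeierstrassCurve ℚ) (d : ℤ), W'.IsElliptic ∧ W'.IsGloballyMinimal ∧
          (d = -1 ∨ d = 2 ∨ d = -2) ∧ 2 ^ 2 ∣ W.conductorNorm ℤ ∧
          IsIsogenous W (W'.quadraticTwist (d : ℚ)) ∧ ¬ 2 ^ 2 ∣ W'.conductorNorm ℤ) →
      ¬ W.HasIrreducibleModPGaloisRep p →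
      500000 < W.conductorNorm ℤ →
      p ∣ D.modularDegree →
      (∀ n : ℕ, W.kodairaSymbolAt ((Rat.HeightOneSpectrum.primesEquiv (R := ℤ)).symm ⟨p, hp⟩) ≠
        .Istar n) →
      ¬ (p : ℤ) ∣ D.maninConstant := by
  intro hM hAU hC hnf W _ _ _ D hD p hp h57 hpN hodd hdy hred hN hdeg hI
  by_cases hv : padicValInt p W.minimalDiscriminantInt ≤ 4
  · exact hlow hM hAU hC hnf W D hD p hp h57 hpN hodd hdy hred hN hdeg hI hv
  · exact hstar hM hAU hC hnf W D hD p hp h57 hpN hodd hdy hred hN hdeg hI (by omega)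

/-- **RED(57♯) BY NAME ⟸ ČNS ∧ K15b (stmt-27071) ∧ `OrdinaryCornerManinResidual` (stmt-27552) ∧ law (U).** Unstarred half: the lead's
flip-twin reduction p622240 over the three Raynaud cells (p625709, fed by §1) and the type-II corner at 5 (μ p623176 from (U)); starred
half: §2. Dokchitser–Dokchitser and the Manin transport θ are NOT used. Conditional result; closes nothing.
[cite: CesnaviciusNeururerSaha2023, Thm. 1.2] [cite: EdixhovenManin1991, Thm. 3] [cite: Stevens1989, §2] -/
theorem coreRED57sharp_of_cns_of_items_of_optimalUnstarredNonGord
    (hCNS : cesnaviciusNeururerSaha_padicVal_maninConstant_le_modularDegree)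
    (hK : Summit.BirchSwinnertonDyer.BirchSwinnertonDyer.Theses.TwistFamilyManinDescent.SupersingularUnstarredStrongManinUnit)
    (hOrd : Summit.BirchSwinnertonDyer.BirchSwinnertonDyer.Theses.TwistFamilyManinDescent.OrdinaryCornerManinResidual)
    (hU : exists_isNewformOf →
      ∀ (W : WeierstrassCurve ℚ) [W.IsElliptic] [W.IsGloballyMinimal] [NeZero (W.conductorNorm ℤ)]
        (D : ModularParametrizationData W (W.conductorNorm ℤ)),
        IsLatticeOptimal D → ∀ (p : ℕ) (hp : p.Prime), (p = 5 ∨ p = 7) → p ^ 2 ∣ W.conductorNorm ℤ →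
        ¬ (∃ (W' : WeierstrassCurve ℚ) (q : ℕ), W'.IsElliptic ∧ W'.IsGloballyMinimal ∧ q.Prime ∧
            q ≠ 2 ∧ q ^ 2 ∣ W.conductorNorm ℤ ∧
            IsIsogenous W (W'.quadraticTwist (((-1 : ℤ) ^ (q / 2) * q : ℤ) : ℚ)) ∧
            ¬ q ^ 2 ∣ W'.conductorNorm ℤ) →
        ¬ (∃ (W' : WeierstrassCurve ℚ) (d : ℤ), W'.IsElliptic ∧ W'.IsGloballyMinimal ∧
            (d = -1 ∨ d = 2 ∨ d = -2) ∧ 2 ^ 2 ∣ W.conductorNorm ℤ ∧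
            IsIsogenous W (W'.quadraticTwist (d : ℚ)) ∧ ¬ 2 ^ 2 ∣ W'.conductorNorm ℤ) →
        ¬ W.HasIrreducibleModPGaloisRep p →
        500000 < W.conductorNorm ℤ →
        (∀ n : ℕ, W.kodairaSymbolAt ((Rat.HeightOneSpectrum.primesEquiv (R := ℤ)).symm ⟨p, hp⟩) ≠
          .Istar n) →
        ¬ TypeGOrd W p →
        padicValInt p W.minimalDiscriminantInt ≤ 4) :
    mazur_not_dvd_maninConstant_of_odd → abbesUllmo_not_dvd_maninConstant_of_not_dvd_level →
    cesnavicius_not_two_dvd_maninConstant_of_two_dvd_level → exists_isNewformOf →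
    ∀ (W : WeierstrassCurve ℚ) [W.IsElliptic] [W.IsGloballyMinimal] [NeZero (W.conductorNorm ℤ)]
      (D : ModularParametrizationData W (W.conductorNorm ℤ)),
      IsLatticeOptimal D → ∀ (p : ℕ) (hp : p.Prime), (p = 5 ∨ p = 7) → p ^ 2 ∣ W.conductorNorm ℤ →
      ¬ (∃ (W' : WeierstrassCurve ℚ) (q : ℕ), W'.IsElliptic ∧ W'.IsGloballyMinimal ∧ q.Prime ∧
          q ≠ 2 ∧ q ^ 2 ∣ W.conductorNorm ℤ ∧
          IsIsogenous W (W'.quadraticTwist (((-1 : ℤ) ^ (q / 2) * q : ℤ) : ℚ)) ∧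
          ¬ q ^ 2 ∣ W'.conductorNorm ℤ) →
      ¬ (∃ (W' : WeierstrassCurve ℚ) (d : ℤ), W'.IsElliptic ∧ W'.IsGloballyMinimal ∧
          (d = -1 ∨ d = 2 ∨ d = -2) ∧ 2 ^ 2 ∣ W.conductorNorm ℤ ∧
          IsIsogenous W (W'.quadraticTwist (d : ℚ)) ∧ ¬ 2 ^ 2 ∣ W'.conductorNorm ℤ) →
      ¬ W.HasIrreducibleModPGaloisRep p →
      500000 < W.conductorNorm ℤ →
      p ∣ D.modularDegree →
      (∀ n : ℕ, W.kodairaSymbolAt ((Rat.HeightOneSpectrum.primesEquiv (R := ℤ)).symm ⟨p, hp⟩) ≠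
        .Istar n) →
      ¬ (p : ℤ) ∣ D.maninConstant :=
  coreRED57sharp_of_unstarred_of_starred
    (coreRED57unstarred_of_cns_of_offTypeIIAtFive_of_typeIIAtFiveCorner hCNS
      (coreRED57unstarredOffII5_of_cells (red57ss_of_ssUnstarredStrong hK) (red7ordIV_of_ordinaryCorner hOrd)
        (red57corner_of_ordinaryCorner hOrd))
      (cornerTypeIIAtFive_of_optimalUnstarredNonGord hU))
    (coreRED57starred_of_ordinaryCorner_of_optimalUnstarredNonGord hOrd hU)

end Summit.BirchSwinnertonDyer.BirchSwinnertonDyer.Theorems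

end
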